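import Summits.ValiantsHypothesis.ValiantsHypothesis.Theorems.SymPencilPerFourCoordinateRadical
import Summits.ValiantsHypothesis.ValiantsHypothesis.Theorems.SymPencilBoxFourEquality

/-!
# Route `SymPencil` — quantitative radical bound, DETECTING-PAIR form
# (`--supports` stmt-ValiantsHypothesis-5674 `SdcSuperquadratic`; rank side of the sizes `22 … 25`,
# the form asked for by the `7`-dimensional trichotomy of val-width-5676-p2 g3)

`SymPencilPerFourCoordinateRadical` proves `2 dim V ≤ |ι| + 8` for a space `V` of `4 × 4` matrices
with two prescribed ZERO rows carrying a family of `|ι|`-square expansions of the `s²`-coefficient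
of `per_4 (u + s y)`.  Here the hypothesis is weakened to: `V ⊆ Sing Z(per_4)` (all `3 × 3`
minor-permanents vanish on `V`) and a pair of rows `p ≠ q` DETECTS `V` (an element of `V` whose rows
`p, q` vanish is zero) — equivalently `V` is a graph over its rows `p, q`; likewise for columns.
This is the shape in which `7`- and `6`-dimensional subspaces of `Sing Z(per_4)` with a detecting
pair occur (row profiles `(4,3,0,0)`), the remaining `7`-dimensional ones being the crosses.

Mechanism.  Base point `u = 𝟙` on the two rows complementary to `p, q`.  For `y ∈ Sing Z(per_4)`
the `s³`- and `s⁴`-coefficients of `per_4 (u + s y)` are sums of `3 × 3` subpermanents of `y` and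
vanish, so `per_4 (u + s y) = s² · H_{pq}(y)` EXACTLY, with `H_{pq}(y) = 2 (S_p S_q − Σ_j y_{pj} y_{qj})`
depending only on rows `p, q` (`eval_perPoly_ones01_add_smul_of_subperm`, canonical `p, q = 2, 3`).
Then the count of `SymPencilPerFourCoordinateRadical` runs verbatim with "rows `p, q` detect" in
place of "the other rows vanish": the common kernel `N` of the `Λ_k` has `dim N ≥ dim V − |ι|`, the
polarisation of `H_{pq}` embeds `N` into the annihilator of `V ⊕ {rows p, q zero}` (injective because
its kernel has rows `p, q` zero, hence meets `V` trivially), so `dim N ≤ 8 − dim V`.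

Honest framing: helper inequalities (`two_mul_finrank_le_card_add_eight_of_detecting`,
`not_sqFamily_of_detecting`); no lower bound is claimed here, the crux and `VP ≠ VNP` are not moved.
No definitions, no named facts. [folklore]
-/

noncomputable section

-- single-conjunct layout: Sub = Summit, duplicated namespace component intended
set_option linter.dupNamespace false

namespace Summit.ValiantsHypothesis.ValiantsHypothesis.Theorems.SymPencilPerFourDetectingRadical

open MvPolynomial Module
open Literature.Computability.AlgebraicComplexity
open Summit.ValiantsHypothesis.ValiantsHypothesis.Theorems.SymPencilPerFourBlocks
open Summit.ValiantsHypothesis.ValiantsHypothesis.Theorems.SymPencilPerFourTwoRowsRadical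
open Summit.ValiantsHypothesis.ValiantsHypothesis.Theorems.SymPencilPerFourCoordinateRadical
open Summit.ValiantsHypothesis.ValiantsHypothesis.Theorems.SymPencilBoxFourEquality

variable {K : Type*} [Field K]

/-- **`per_4 (𝟙_{rows 0,1} + s x) = s² · H₂₃(x)` for `x ∈ Sing Z(per_4)`** (no zero-row
hypothesis): the `s³`-coefficient is a sum of eight `3 × 3` subpermanents of `x` and the
`s⁴`-coefficient is `per x`, both of which vanish. [folklore] -/
theorem eval_perPoly_ones01_add_smul_of_subperm (x : Fin 4 × Fin 4 → K)
    (hx : ∀ (r c : Fin 3 → Fin 4), Function.Injective r → Function.Injective c →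
      ((Matrix.of fun i j => x (i, j)).submatrix r c).permanent = 0) (s : K) :
    eval ((fun p : Fin 4 × Fin 4 => if p.1 = 0 then (1 : K) else if p.1 = 1 then 1 else 0) + s • x)
        (perPoly (Fin 4) K) =
      s ^ 2 * (2 * ((x (2, 0) + x (2, 1) + x (2, 2) + x (2, 3)) *
          (x (3, 0) + x (3, 1) + x (3, 2) + x (3, 3)) -
        (x (2, 0) * x (3, 0) + x (2, 1) * x (3, 1) + x (2, 2) * x (3, 2) + x (2, 3) * x (3, 3)))) := by
  have h := fun i j : Fin 4 =>
    hx (Fin.succAbove i) (Fin.succAbove j) Fin.succAbove_right_injective Fin.succAbove_right_injective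
  have h00 := h 0 0; have h01 := h 0 1; have h02 := h 0 2; have h03 := h 0 3
  have h10 := h 1 0; have h11 := h 1 1; have h12 := h 1 2; have h13 := h 1 3
  have e00 : (0 : Fin 4).succAbove 0 = 1 := by decide
  have e01 : (0 : Fin 4).succAbove 1 = 2 := by decide
  have e02 : (0 : Fin 4).succAbove 2 = 3 := by decide
  have e10 : (1 : Fin 4).succAbove 0 = 0 := by decide
  have e11 : (1 : Fin 4).succAbove 1 = 2 := by decide
  have e12 : (1 : Fin 4).succAbove 2 = 3 := by decide
  have e20 : (2 : Fin 4).succAbove 0 = 0 := by decide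
  have e21 : (2 : Fin 4).succAbove 1 = 1 := by decide
  have e22 : (2 : Fin 4).succAbove 2 = 3 := by decide
  have e30 : (3 : Fin 4).succAbove 0 = 0 := by decide
  have e31 : (3 : Fin 4).succAbove 1 = 1 := by decide
  have e32 : (3 : Fin 4).succAbove 2 = 2 := by decide
  simp only [Matrix.permanent_fin_three_row, Matrix.submatrix_apply, Matrix.of_apply,
    e00, e01, e02, e10, e11, e12, e20, e21, e22, e30, e31, e32] at h00 h01 h02 h03 h10 h11 h12 h13
  rw [eval_perPoly, Matrix.permanent_fin_four_row]
  simp only [Matrix.of_apply, Pi.add_apply, Pi.smul_apply, smul_eq_mul,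
    show ((2 : Fin 4) = 0) = False by decide, show ((2 : Fin 4) = 1) = False by decide,
    show ((3 : Fin 4) = 0) = False by decide, show ((3 : Fin 4) = 1) = False by decide,
    show ((1 : Fin 4) = 0) = False by decide, if_true, if_false, zero_add]
  linear_combination s ^ 3 * (h00 + h01 + h02 + h03 + h10 + h11 + h12 + h13) +
    s ^ 4 * (x (0, 0) * h00 + x (0, 1) * h01 + x (0, 2) * h02 + x (0, 3) * h03)

/-- **Non-degeneracy count, detecting form (canonical rows `2, 3`).**  If rows `2, 3` detect `V`,
`N ≤ V`, and translation by `N` leaves `H₂₃` unchanged on `V`, then `dim N + dim V ≤ 8`.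
(Same count as `SymPencilPerFourCoordinateRadical.finrank_add_finrank_le_eight_rows01`; the
kernel of the polarisation has rows `2, 3` zero, so it meets `V` trivially.) [folklore] -/
theorem finrank_add_finrank_le_eight_det23 [CharZero K] (V N : Submodule K (Fin 4 × Fin 4 → K))
    (hdet : ∀ x ∈ V, (∀ j, x (2, j) = 0) → (∀ j, x (3, j) = 0) → x = 0) (hNV : N ≤ V)
    (hrad : ∀ x₀ ∈ N, ∀ y ∈ V,
      2 * (((x₀ + y) (2, 0) + (x₀ + y) (2, 1) + (x₀ + y) (2, 2) + (x₀ + y) (2, 3)) *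
            ((x₀ + y) (3, 0) + (x₀ + y) (3, 1) + (x₀ + y) (3, 2) + (x₀ + y) (3, 3)) -
          ((x₀ + y) (2, 0) * (x₀ + y) (3, 0) + (x₀ + y) (2, 1) * (x₀ + y) (3, 1) +
            (x₀ + y) (2, 2) * (x₀ + y) (3, 2) + (x₀ + y) (2, 3) * (x₀ + y) (3, 3))) =
      2 * ((y (2, 0) + y (2, 1) + y (2, 2) + y (2, 3)) * (y (3, 0) + y (3, 1) + y (3, 2) + y (3, 3)) -
          (y (2, 0) * y (3, 0) + y (2, 1) * y (3, 1) + y (2, 2) * y (3, 2) + y (2, 3) * y (3, 3)))) :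
    finrank K N + finrank K V ≤ 8 := by
  classical
  let B : (Fin 4 × Fin 4 → K) → (Fin 4 × Fin 4 → K) → K := fun x y =>
    2 * ((x (2, 0) + x (2, 1) + x (2, 2) + x (2, 3)) * (y (3, 0) + y (3, 1) + y (3, 2) + y (3, 3)) +
        (y (2, 0) + y (2, 1) + y (2, 2) + y (2, 3)) * (x (3, 0) + x (3, 1) + x (3, 2) + x (3, 3)) -
      (x (2, 0) * y (3, 0) + x (2, 1) * y (3, 1) + x (2, 2) * y (3, 2) + x (2, 3) * y (3, 3) +
        (y (2, 0) * x (3, 0) + y (2, 1) * x (3, 1) + y (2, 2) * x (3, 2) + y (2, 3) * x (3, 3))))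
  have hB : ∀ x y, B x y =
    2 * ((x (2, 0) + x (2, 1) + x (2, 2) + x (2, 3)) * (y (3, 0) + y (3, 1) + y (3, 2) + y (3, 3)) +
        (y (2, 0) + y (2, 1) + y (2, 2) + y (2, 3)) * (x (3, 0) + x (3, 1) + x (3, 2) + x (3, 3)) -
      (x (2, 0) * y (3, 0) + x (2, 1) * y (3, 1) + x (2, 2) * y (3, 2) + x (2, 3) * y (3, 3) +
        (y (2, 0) * x (3, 0) + y (2, 1) * x (3, 1) + y (2, 2) * x (3, 2) + y (2, 3) * x (3, 3)))) :=
    fun x y => rfl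
  let β : (Fin 4 × Fin 4 → K) →ₗ[K] Module.Dual K (Fin 4 × Fin 4 → K) :=
    LinearMap.mk₂ K B
      (fun x₁ x₂ y => by simp only [hB, Pi.add_apply]; ring)
      (fun c x y => by simp only [hB, Pi.smul_apply, smul_eq_mul]; ring)
      (fun x y₁ y₂ => by simp only [hB, Pi.add_apply]; ring)
      (fun c x y => by simp only [hB, Pi.smul_apply, smul_eq_mul]; ring)
  have hβ : ∀ x y, β x y = B x y := fun x y => rfl
  have hz : ∀ x₀ ∈ N,
      2 * ((x₀ (2, 0) + x₀ (2, 1) + x₀ (2, 2) + x₀ (2, 3)) *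
          (x₀ (3, 0) + x₀ (3, 1) + x₀ (3, 2) + x₀ (3, 3)) -
        (x₀ (2, 0) * x₀ (3, 0) + x₀ (2, 1) * x₀ (3, 1) + x₀ (2, 2) * x₀ (3, 2) +
          x₀ (2, 3) * x₀ (3, 3))) = 0 := fun x₀ hx₀ => by
    simpa using hrad x₀ hx₀ 0 V.zero_mem
  have hBV : ∀ x₀ ∈ N, ∀ y ∈ V, β x₀ y = 0 := by
    intro x₀ hx₀ y hy
    have h := hrad x₀ hx₀ y hy
    have h0 := hz x₀ hx₀
    simp only [Pi.add_apply] at h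
    rw [hβ, hB]
    linear_combination h - h0
  have hBW : ∀ x y : Fin 4 × Fin 4 → K, (∀ j, y (2, j) = 0) → (∀ j, y (3, j) = 0) → β x y = 0 := by
    intro x y h2 h3
    rw [hβ, hB]
    simp [h2, h3]
  -- the complementary block `W'` (rows `2, 3` zero): `dim W' = 8`, `V ⊓ W' = 0` by detection
  let ρ : Fin 4 → (Fin 4 × Fin 4 → K) →ₗ[K] (Fin 4 → K) :=
    fun r => LinearMap.funLeft K K fun j => (r, j)
  let W' : Submodule K (Fin 4 × Fin 4 → K) := LinearMap.ker (ρ 2) ⊓ LinearMap.ker (ρ 3)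
  have hW'mem : ∀ y ∈ W', (∀ j, y (2, j) = 0) ∧ ∀ j, y (3, j) = 0 := fun y hy => by
    simp only [W', Submodule.mem_inf, LinearMap.mem_ker] at hy
    exact ⟨fun j => congr_fun hy.1 j, fun j => congr_fun hy.2 j⟩
  have hW' : finrank K W' = 8 := finrank_rowsZero 2 3 (by decide)
  have hinf : V ⊓ W' = ⊥ := by
    rw [eq_bot_iff]
    intro y hy
    obtain ⟨hyV, hyW⟩ := Submodule.mem_inf.1 hy
    rw [Submodule.mem_bot]
    exact hdet y hyV (hW'mem y hyW).1 (hW'mem y hyW).2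
  have hsup : finrank K ↥(V ⊔ W') = finrank K V + 8 := by
    have h := Submodule.finrank_sup_add_finrank_inf_eq V W'
    rw [hinf, finrank_bot, hW'] at h
    omega
  have hann : finrank K ↥(V ⊔ W') + finrank K ↥((V ⊔ W').dualAnnihilator) = 16 := by
    rw [Subspace.finrank_add_finrank_dualAnnihilator_eq, finrank_fintype_fun_eq_card,
      Fintype.card_prod, Fintype.card_fin]
  let g : ↥N →ₗ[K] Module.Dual K (Fin 4 × Fin 4 → K) := β.comp N.subtype
  have hrange : LinearMap.range g ≤ (V ⊔ W').dualAnnihilator := by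
    rintro _ ⟨⟨x₀, hx₀⟩, rfl⟩
    rw [Submodule.mem_dualAnnihilator]
    intro w hw
    obtain ⟨y, hy, y', hy', rfl⟩ := Submodule.mem_sup.1 hw
    show β x₀ (y + y') = 0
    rw [map_add, hBV x₀ hx₀ y hy, hBW x₀ y' (hW'mem y' hy').1 (hW'mem y' hy').2, add_zero]
  have hker : LinearMap.ker g = ⊥ := by
    rw [eq_bot_iff]
    rintro ⟨x₀, hx₀⟩ hg
    rw [LinearMap.mem_ker] at hg
    have hgx : ∀ y, β x₀ y = 0 := fun y => LinearMap.congr_fun hg y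
    rw [Submodule.mem_bot, Subtype.ext_iff, Submodule.coe_mk, Submodule.coe_zero]
    have hx₀V : x₀ ∈ V := hNV hx₀
    have t30 := hgx (Pi.single (3, 0) 1)
    have t31 := hgx (Pi.single (3, 1) 1)
    have t32 := hgx (Pi.single (3, 2) 1)
    have t33 := hgx (Pi.single (3, 3) 1)
    have t20 := hgx (Pi.single (2, 0) 1)
    have t21 := hgx (Pi.single (2, 1) 1)
    have t22 := hgx (Pi.single (2, 2) 1)
    have t23 := hgx (Pi.single (2, 3) 1)
    simp only [hβ, hB, Pi.single_apply, Prod.mk.injEq,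
      show ((2 : Fin 4) = 3) = False by decide, show ((3 : Fin 4) = 2) = False by decide,
      show ((0 : Fin 4) = 1) = False by decide, show ((0 : Fin 4) = 2) = False by decide,
      show ((0 : Fin 4) = 3) = False by decide, show ((1 : Fin 4) = 0) = False by decide,
      show ((1 : Fin 4) = 2) = False by decide, show ((1 : Fin 4) = 3) = False by decide,
      show ((2 : Fin 4) = 0) = False by decide, show ((2 : Fin 4) = 1) = False by decide,
      show ((3 : Fin 4) = 0) = False by decide, show ((3 : Fin 4) = 1) = False by decide,
      and_true, and_false, if_true, if_false, add_zero, zero_add, mul_one,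
      mul_zero, zero_mul] at t30 t31 t32 t33 t20 t21 t22 t23
    set a0 := x₀ (2, 0); set a1 := x₀ (2, 1); set a2 := x₀ (2, 2); set a3 := x₀ (2, 3)
    set b0 := x₀ (3, 0); set b1 := x₀ (3, 1); set b2 := x₀ (3, 2); set b3 := x₀ (3, 3)
    have hSa : a0 + a1 + a2 + a3 = 0 := by
      have h6 : (6 : K) * (a0 + a1 + a2 + a3) = 0 := by linear_combination t30 + t31 + t32 + t33
      exact (mul_eq_zero.1 h6).resolve_left (by norm_num)
    have hSb : b0 + b1 + b2 + b3 = 0 := by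
      have h6 : (6 : K) * (b0 + b1 + b2 + b3) = 0 := by linear_combination t20 + t21 + t22 + t23
      exact (mul_eq_zero.1 h6).resolve_left (by norm_num)
    have ha0 : a0 = 0 := (mul_eq_zero.1 (show (2 : K) * a0 = 0 by
      linear_combination 2 * hSa - t30)).resolve_left two_ne_zero
    have ha1 : a1 = 0 := (mul_eq_zero.1 (show (2 : K) * a1 = 0 by
      linear_combination 2 * hSa - t31)).resolve_left two_ne_zero
    have ha2 : a2 = 0 := (mul_eq_zero.1 (show (2 : K) * a2 = 0 by
      linear_combination 2 * hSa - t32)).resolve_left two_ne_zero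
    have ha3 : a3 = 0 := (mul_eq_zero.1 (show (2 : K) * a3 = 0 by
      linear_combination 2 * hSa - t33)).resolve_left two_ne_zero
    have hb0 : b0 = 0 := (mul_eq_zero.1 (show (2 : K) * b0 = 0 by
      linear_combination 2 * hSb - t20)).resolve_left two_ne_zero
    have hb1 : b1 = 0 := (mul_eq_zero.1 (show (2 : K) * b1 = 0 by
      linear_combination 2 * hSb - t21)).resolve_left two_ne_zero
    have hb2 : b2 = 0 := (mul_eq_zero.1 (show (2 : K) * b2 = 0 by
      linear_combination 2 * hSb - t22)).resolve_left two_ne_zero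
    have hb3 : b3 = 0 := (mul_eq_zero.1 (show (2 : K) * b3 = 0 by
      linear_combination 2 * hSb - t23)).resolve_left two_ne_zero
    have hcases : ∀ i : Fin 4, i = 0 ∨ i = 1 ∨ i = 2 ∨ i = 3 := by decide
    refine hdet x₀ hx₀V (fun j => ?_) (fun j => ?_)
    · rcases hcases j with rfl | rfl | rfl | rfl <;> assumption
    · rcases hcases j with rfl | rfl | rfl | rfl <;> assumption
  have hN : finrank K N = finrank K (LinearMap.range g) := by
    have h := g.finrank_range_add_finrank_ker
    rw [hker, finrank_bot, add_zero] at h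
    exact h.symm
  have hle : finrank K (LinearMap.range g) ≤ finrank K ↥((V ⊔ W').dualAnnihilator) :=
    Submodule.finrank_mono hrange
  omega

/-- **Canonical position, one base point, detecting form.**  `V ⊆ Sing Z(per_4)`, rows `2, 3`
detect `V`; if at `u = 𝟙_{rows 0,1}` the `s²`-coefficient along `V` is `Σ_{k ∈ ι} c_k (Λ_k x)²`,
then `2 dim V ≤ |ι| + 8`. [folklore] -/
theorem two_mul_finrank_le_det23 [CharZero K] {ι : Type*} [Fintype ι]
    (V : Submodule K (Fin 4 × Fin 4 → K))
    (hW : ∀ x ∈ V, ∀ (r c : Fin 3 → Fin 4), Function.Injective r → Function.Injective c →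
      ((Matrix.of fun i j => x (i, j)).submatrix r c).permanent = 0)
    (hdet : ∀ x ∈ V, (∀ j, x (2, j) = 0) → (∀ j, x (3, j) = 0) → x = 0)
    (c : ι → K) (Λ : ι → ((Fin 4 × Fin 4 → K) →ₗ[K] K))
    (he : ∀ x ∈ V, ∃ e₀ e₁ : K, ∀ s : K,
      eval ((fun p : Fin 4 × Fin 4 => if p.1 = 0 then (1 : K) else if p.1 = 1 then 1 else 0) + s • x)
        (perPoly (Fin 4) K) = e₀ + s * e₁ + s ^ 2 * ∑ k, c k * (Λ k x) ^ 2) :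
    2 * finrank K V ≤ Fintype.card ι + 8 := by
  have he₂ : ∀ x ∈ V, ∑ k, c k * (Λ k x) ^ 2 =
      2 * ((x (2, 0) + x (2, 1) + x (2, 2) + x (2, 3)) * (x (3, 0) + x (3, 1) + x (3, 2) + x (3, 3)) -
        (x (2, 0) * x (3, 0) + x (2, 1) * x (3, 1) + x (2, 2) * x (3, 2) + x (2, 3) * x (3, 3))) := by
    intro x hx
    obtain ⟨e₀, e₁, h⟩ := he x hx
    have P : ∀ s : K, e₀ + s * e₁ + s ^ 2 * ∑ k, c k * (Λ k x) ^ 2 = s ^ 2 *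
        (2 * ((x (2, 0) + x (2, 1) + x (2, 2) + x (2, 3)) * (x (3, 0) + x (3, 1) + x (3, 2) + x (3, 3)) -
          (x (2, 0) * x (3, 0) + x (2, 1) * x (3, 1) + x (2, 2) * x (3, 2) + x (2, 3) * x (3, 3)))) :=
      fun s => by rw [← h s, eval_perPoly_ones01_add_smul_of_subperm x (hW x hx)]
    have h0 := P 0; have h1 := P 1; have h1' := P (-1)
    have h2 : (2 : K) * ∑ k, c k * (Λ k x) ^ 2 = 2 *
        (2 * ((x (2, 0) + x (2, 1) + x (2, 2) + x (2, 3)) * (x (3, 0) + x (3, 1) + x (3, 2) + x (3, 3)) -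
          (x (2, 0) * x (3, 0) + x (2, 1) * x (3, 1) + x (2, 2) * x (3, 2) + x (2, 3) * x (3, 3)))) := by
      linear_combination h1 + h1' - 2 * h0
    exact (mul_right_inj' two_ne_zero).1 h2
  obtain ⟨N, hNV, hdim, hN⟩ := exists_commonKernel V Λ
  have hrad : ∀ x₀ ∈ N, ∀ y ∈ V,
      2 * (((x₀ + y) (2, 0) + (x₀ + y) (2, 1) + (x₀ + y) (2, 2) + (x₀ + y) (2, 3)) *
            ((x₀ + y) (3, 0) + (x₀ + y) (3, 1) + (x₀ + y) (3, 2) + (x₀ + y) (3, 3)) -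
          ((x₀ + y) (2, 0) * (x₀ + y) (3, 0) + (x₀ + y) (2, 1) * (x₀ + y) (3, 1) +
            (x₀ + y) (2, 2) * (x₀ + y) (3, 2) + (x₀ + y) (2, 3) * (x₀ + y) (3, 3))) =
      2 * ((y (2, 0) + y (2, 1) + y (2, 2) + y (2, 3)) * (y (3, 0) + y (3, 1) + y (3, 2) + y (3, 3)) -
          (y (2, 0) * y (3, 0) + y (2, 1) * y (3, 1) + y (2, 2) * y (3, 2) + y (2, 3) * y (3, 3))) := by
    intro x₀ hx₀ y hy
    rw [← he₂ y hy, ← he₂ (x₀ + y) (V.add_mem (hNV hx₀) hy)]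
    refine Finset.sum_congr rfl fun k _ => ?_
    rw [map_add, hN x₀ hx₀ k, zero_add]
  have h8 := finrank_add_finrank_le_eight_det23 V N hdet hNV hrad
  omega

/-- The `3 × 3` minor-permanent hypothesis is invariant under permuting rows and columns.
[folklore] -/
theorem subperm_vanish_map_prodCongr (V : Submodule K (Fin 4 × Fin 4 → K))
    (σ τ : Equiv.Perm (Fin 4))
    (hW : ∀ x ∈ V, ∀ (r c : Fin 3 → Fin 4), Function.Injective r → Function.Injective c →
      ((Matrix.of fun i j => x (i, j)).submatrix r c).permanent = 0) :
    ∀ y ∈ V.map (LinearEquiv.funCongrLeft K K (Equiv.prodCongr σ τ)).toLinearMap,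
      ∀ (r c : Fin 3 → Fin 4), Function.Injective r → Function.Injective c →
      ((Matrix.of fun i j => y (i, j)).submatrix r c).permanent = 0 := by
  rintro _ ⟨x, hx, rfl⟩ r c hr hc
  have h : (Matrix.of fun i j =>
      (LinearEquiv.funCongrLeft K K (Equiv.prodCongr σ τ)).toLinearMap x (i, j)).submatrix r c =
      (Matrix.of fun i j => x (i, j)).submatrix (σ ∘ r) (τ ∘ c) := by
    ext i j
    rfl
  rw [h]
  exact hW x hx _ _ (σ.injective.comp hr) (τ.injective.comp hc)

/-- **A detecting pair of ROWS.**  `V ⊆ Sing Z(per_4)`, rows `p ≠ q` detect `V`, and the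
`s²`-coefficient has a `|ι|`-square expansion at every base point: then `2 dim V ≤ |ι| + 8`.
[folklore] -/
theorem two_mul_finrank_le_of_detecting_rows [CharZero K] {ι : Type*} [Fintype ι]
    (V : Submodule K (Fin 4 × Fin 4 → K))
    (hW : ∀ x ∈ V, ∀ (r c : Fin 3 → Fin 4), Function.Injective r → Function.Injective c →
      ((Matrix.of fun i j => x (i, j)).submatrix r c).permanent = 0)
    {p q : Fin 4} (hpq : p ≠ q) (hdet : ∀ x ∈ V, (∀ j, x (p, j) = 0) → (∀ j, x (q, j) = 0) → x = 0)
    (hform : ∀ u : Fin 4 × Fin 4 → K, ∃ (c : ι → K) (Λ : ι → ((Fin 4 × Fin 4 → K) →ₗ[K] K)),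
      ∀ y ∈ V, ∃ e₀ e₁ : K, ∀ s : K,
        eval (u + s • y) (perPoly (Fin 4) K) = e₀ + s * e₁ + s ^ 2 * ∑ k, c k * (Λ k y) ^ 2) :
    2 * finrank K V ≤ Fintype.card ι + 8 := by
  obtain ⟨σ₀, hσ0, hσ1⟩ := exists_perm_zero_one p q hpq
  -- `σ 2 = p`, `σ 3 = q`
  set κ : Equiv.Perm (Fin 4) := (Equiv.swap (0 : Fin 4) 2).trans (Equiv.swap (1 : Fin 4) 3) with hκ
  have hκ2 : κ 2 = 0 := by decide
  have hκ3 : κ 3 = 1 := by decide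
  set σ : Equiv.Perm (Fin 4) := κ.trans σ₀ with hσ
  have hσ2 : σ 2 = p := by rw [hσ, Equiv.trans_apply, hκ2, hσ0]
  have hσ3 : σ 3 = q := by rw [hσ, Equiv.trans_apply, hκ3, hσ1]
  set e := Equiv.prodCongr σ (1 : Equiv.Perm (Fin 4)) with he
  set Φ : (Fin 4 × Fin 4 → K) ≃ₗ[K] (Fin 4 × Fin 4 → K) := LinearEquiv.funCongrLeft K K e with hΦ
  have hΦa : ∀ (x : Fin 4 × Fin 4 → K) (i j : Fin 4), Φ x (i, j) = x (σ i, j) := fun x i j => by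
    simp [hΦ, he]
  have hΦper : ∀ z, eval (Φ z) (perPoly (Fin 4) K) = eval z (perPoly (Fin 4) K) := fun z => by
    have : (Φ z : Fin 4 × Fin 4 → K) = z ∘ e := rfl
    rw [this, he, eval_perPoly_comp_prodCongr]
  have hform' := sqFamily_map V Φ hΦper hform
  set V' := V.map Φ.toLinearMap with hV'def
  have hfin : finrank K V' = finrank K V := by rw [hV'def, LinearEquiv.finrank_map_eq]
  have hW' : ∀ y ∈ V', ∀ (r c : Fin 3 → Fin 4), Function.Injective r → Function.Injective c →
      ((Matrix.of fun i j => y (i, j)).submatrix r c).permanent = 0 := by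
    rw [hV'def, hΦ, he]
    exact subperm_vanish_map_prodCongr V σ 1 hW
  have hdet' : ∀ y ∈ V', (∀ j, y (2, j) = 0) → (∀ j, y (3, j) = 0) → y = 0 := by
    rintro _ ⟨x, hx, rfl⟩ h2 h3
    have hx0 : x = 0 := by
      refine hdet x hx (fun j => ?_) (fun j => ?_)
      · have := h2 j
        rwa [LinearEquiv.coe_toLinearMap, hΦa, hσ2] at this
      · have := h3 j
        rwa [LinearEquiv.coe_toLinearMap, hΦa, hσ3] at this
    rw [hx0, map_zero]
  obtain ⟨c, Λ, he'⟩ :=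
    hform' (fun r : Fin 4 × Fin 4 => if r.1 = 0 then (1 : K) else if r.1 = 1 then 1 else 0)
  have h := two_mul_finrank_le_det23 V' hW' hdet' c Λ he'
  omega

/-- **A detecting pair of rows OR of columns** (`V ⊆ Sing Z(per_4)`): a family of `|ι|`-square
expansions of the `s²`-coefficient forces `2 dim V ≤ |ι| + 8`.  (`dim V = 7`: `|ι| ≥ 6`;
`dim V = 6`: `|ι| ≥ 4`.) [folklore] -/
theorem two_mul_finrank_le_card_add_eight_of_detecting [CharZero K] {ι : Type*} [Fintype ι]
    (V : Submodule K (Fin 4 × Fin 4 → K))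
    (hW : ∀ x ∈ V, ∀ (r c : Fin 3 → Fin 4), Function.Injective r → Function.Injective c →
      ((Matrix.of fun i j => x (i, j)).submatrix r c).permanent = 0)
    (hdet : (∃ p q : Fin 4, p ≠ q ∧ ∀ x ∈ V, (∀ j, x (p, j) = 0) → (∀ j, x (q, j) = 0) → x = 0) ∨
      (∃ p q : Fin 4, p ≠ q ∧ ∀ x ∈ V, (∀ i, x (i, p) = 0) → (∀ i, x (i, q) = 0) → x = 0))
    (hform : ∀ u : Fin 4 × Fin 4 → K, ∃ (c : ι → K) (Λ : ι → ((Fin 4 × Fin 4 → K) →ₗ[K] K)),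
      ∀ y ∈ V, ∃ e₀ e₁ : K, ∀ s : K,
        eval (u + s • y) (perPoly (Fin 4) K) = e₀ + s * e₁ + s ^ 2 * ∑ k, c k * (Λ k y) ^ 2) :
    2 * finrank K V ≤ Fintype.card ι + 8 := by
  rcases hdet with ⟨p, q, hpq, hdet⟩ | ⟨p, q, hpq, hdet⟩
  · exact two_mul_finrank_le_of_detecting_rows V hW hpq hdet hform
  · -- transpose, then the row case
    set Φ : (Fin 4 × Fin 4 → K) ≃ₗ[K] (Fin 4 × Fin 4 → K) :=
      LinearEquiv.funCongrLeft K K (Equiv.prodComm (Fin 4) (Fin 4)) with hΦ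
    have hΦa : ∀ (x : Fin 4 × Fin 4 → K) (i j : Fin 4), Φ x (i, j) = x (j, i) := fun x i j => rfl
    have hform' := sqFamily_map V Φ eval_perPoly_transpose hform
    set V' := V.map Φ.toLinearMap with hV'def
    have hfin : finrank K V' = finrank K V := by rw [hV'def, LinearEquiv.finrank_map_eq]
    have hW' := subperm_vanish_transpose V hW
    have hdet' : ∀ y ∈ V', (∀ j, y (p, j) = 0) → (∀ j, y (q, j) = 0) → y = 0 := by
      rintro _ ⟨x, hx, rfl⟩ h2 h3
      have hx0 : x = 0 := hdet x hx (fun i => h2 i) (fun i => h3 i)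
      rw [hx0, map_zero]
    have h := two_mul_finrank_le_of_detecting_rows V' hW' hpq hdet' hform'
    omega

/-- **Negative, fixed-weights form** (the shape of the hypotheses `H7ₖ`, `H6ₖ` of
`SymPencilSdcPerFourLadder.le_of_noSqFamily`): a `d`-dimensional `V ⊆ Sing Z(per_4)` with a
detecting pair of rows or columns and `|ι| + 8 < 2 d` carries no `|ι|`-square family. [folklore] -/
theorem not_sqFamily_of_detecting [CharZero K] {ι : Type*} [Fintype ι]
    (V : Submodule K (Fin 4 × Fin 4 → K))
    (hW : ∀ x ∈ V, ∀ (r c : Fin 3 → Fin 4), Function.Injective r → Function.Injective c →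
      ((Matrix.of fun i j => x (i, j)).submatrix r c).permanent = 0)
    (hdet : (∃ p q : Fin 4, p ≠ q ∧ ∀ x ∈ V, (∀ j, x (p, j) = 0) → (∀ j, x (q, j) = 0) → x = 0) ∨
      (∃ p q : Fin 4, p ≠ q ∧ ∀ x ∈ V, (∀ i, x (i, p) = 0) → (∀ i, x (i, q) = 0) → x = 0))
    (hlt : Fintype.card ι + 8 < 2 * finrank K V) (c : ι → K) :
    ¬ (∀ u : Fin 4 × Fin 4 → K, ∃ Λ : ι → ((Fin 4 × Fin 4 → K) →ₗ[K] K),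
        ∀ y ∈ V, ∃ e₀ e₁ : K, ∀ s : K,
          eval (u + s • y) (perPoly (Fin 4) K) = e₀ + s * e₁ + s ^ 2 * ∑ k, c k * (Λ k y) ^ 2) :=
  fun h => absurd (two_mul_finrank_le_card_add_eight_of_detecting V hW hdet fun u => by
    obtain ⟨Λ, hΛ⟩ := h u
    exact ⟨c, Λ, hΛ⟩) (not_le.2 hlt)

end Summit.ValiantsHypothesis.ValiantsHypothesis.Theorems.SymPencilPerFourDetectingRadical

end
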